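import Summits.AtomisticToContinuum.BoseEinsteinCondensation.Theorems.GaussianDominationCan.Negative.StructureII
import Summits.AtomisticToContinuum.BoseEinsteinCondensation.Theorems.GaussianDominationCan.Negative.CruxForms
import Literature.MathematicalPhysics.QuantumManyBody.PeriodicBoseGasRelabelling
import HarnessLib

/-!
# Crux `GaussianDominationCan`, line `coupling-monotone-chord` — stub A2 `stub_thetaNorm`

**Bose counting**: `N ∫_{cell^N} |Θ|² ≤ 1` for `Θ = Σ_{S ∋ 0} |S|^{-1/2} Q_S ψ` (`Negative.theta`)
of a periodic Bose trial state `ψ`, `N = m + 1`.  On continuous functions the cell averages `P_i`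
(`Negative.cellAvg`) are commuting self-adjoint idempotents (`Negative.Structure{,II}`), so
`P_i Q_S g = [i ∈ S] Q_S g` (`cellAvg_modeProj`), the `Q_S g` are pairwise orthogonal in
`L²(cell^N)` with `Σ_S Q_S g = g` (`sum_modeProj`), and `∫|Σ_S c_S Q_S g|² = Σ_S |c_S|² ∫|Q_S g|²`
(`integral_norm_sq_sum_modeProj`).  Relabelling `X ↦ X ∘ τ` intertwines `Q_S` with `Q_{τS}`
(`modeProj_comp_perm`: the `foldr` does not depend on the order of its commuting factors), so by
Bose symmetry `∫|Q_{τS}ψ|² = ∫|Q_Sψ|²` and `N Σ_{S∋0} |S|⁻¹ ∫|Q_Sψ|² = Σ_i Σ_{S∋i} |S|⁻¹ ∫|Q_Sψ|²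
= Σ_{S≠∅} ∫|Q_Sψ|² ≤ ∫|ψ|² = 1`.  All [folklore] (Lieb–Seiringer–Solovej–Yngvason 2005, App. A).
-/

noncomputable section

namespace Summit.AtomisticToContinuum.BoseEinsteinCondensation.Cruxes.GaussianDominationCan.CouplingMonotoneChord

open MeasureTheory
open scoped ENNReal NNReal ComplexConjugate
open Literature.MathematicalPhysics.QuantumManyBody.BoseGas
open Summit.AtomisticToContinuum.BoseEinsteinCondensation.Theorems.GaussianDominationCan.Negative

variable {N : ℕ} {L : ℝ}

/-- Each step `P_i` / `1 - P_i` of the `foldr` preserves continuity. [folklore] -/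
private theorem continuous_foldr (S : Finset (Fin N)) (l : List (Fin N)) {g : Config N → ℂ}
    (hg : Continuous g) :
    Continuous (l.foldr (fun i h => if i ∈ S then cellAvg N L i h else h - cellAvg N L i h) g) := by
  induction l with
  | nil => simpa only [List.foldr_nil] using hg
  | cons a l ih =>
    rw [List.foldr_cons]
    by_cases haS : a ∈ S
    · rw [if_pos haS]; exact continuous_cellAvg a ih
    · rw [if_neg haS]; exact ih.sub (continuous_cellAvg a ih)

/-- `Q_S g` is continuous for continuous `g`. [folklore] -/
private theorem continuous_modeProj (S : Finset (Fin N)) {g : Config N → ℂ} (hg : Continuous g) :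
    Continuous (modeProj N L S g) :=
  continuous_foldr S (List.finRange N) hg

/-- `P_i 0 = 0`. [folklore] -/
private theorem cellAvg_zero (i : Fin N) : cellAvg N L i (0 : Config N → ℂ) = 0 := by
  funext X; simp [cellAvg]

/-- `P_i` on the `foldr` over a duplicate-free list containing `i`: the identity if `i ∈ S`, zero
otherwise (commute `P_i` through the outer factors to its own; `P_i² = P_i`, `P_i(1 - P_i) = 0`). -/
private theorem cellAvg_foldr (hL : 0 < L) (S : Finset (Fin N)) (l : List (Fin N)) (hl : l.Nodup)
    {g : Config N → ℂ} (hg : Continuous g) (i : Fin N) (hi : i ∈ l) :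
    cellAvg N L i (l.foldr (fun i h => if i ∈ S then cellAvg N L i h else h - cellAvg N L i h) g) =
      if i ∈ S then l.foldr (fun i h => if i ∈ S then cellAvg N L i h else h - cellAvg N L i h) g
      else 0 := by
  induction l with
  | nil => simp at hi
  | cons a l ih =>
    rw [List.nodup_cons] at hl
    have hc := continuous_foldr (L := L) S l hg
    rw [List.foldr_cons]
    rcases List.mem_cons.1 hi with hia | hil
    · rw [hia]
      by_cases haS : a ∈ S
      · rw [if_pos haS, if_pos haS]
        exact cellAvg_cellAvg hL a _
      · rw [if_neg haS, if_neg haS]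
        exact cellAvg_sub_cellAvg hL a _ fun X =>
          integrableOn_cell (hc.comp ((continuous_const (y := X)).update a continuous_id))
    · have key := ih hl.2 hil
      by_cases haS : a ∈ S
      · rw [if_pos haS, cellAvg_comm i a hc, key]
        by_cases hiS : i ∈ S
        · rw [if_pos hiS, if_pos hiS]
        · rw [if_neg hiS, if_neg hiS, cellAvg_zero]
      · rw [if_neg haS, cellAvg_sub i hc (continuous_cellAvg a hc), cellAvg_comm i a hc, key]
        by_cases hiS : i ∈ S
        · rw [if_pos hiS, if_pos hiS]
        · rw [if_neg hiS, if_neg hiS, cellAvg_zero, sub_zero]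

/-- **`P_i Q_S g = [i ∈ S] Q_S g`** on continuous `g`. [folklore] -/
private theorem cellAvg_modeProj (hL : 0 < L) (S : Finset (Fin N)) (i : Fin N) {g : Config N → ℂ}
    (hg : Continuous g) :
    cellAvg N L i (modeProj N L S g) = if i ∈ S then modeProj N L S g else 0 :=
  cellAvg_foldr hL S (List.finRange N) (List.nodup_finRange N) hg i (List.mem_finRange i)

/-- The `foldr` sees `S` only through the membership of the listed indices. [folklore] -/
private theorem foldr_congr_set {S T : Finset (Fin N)} (l : List (Fin N))
    (hST : ∀ i ∈ l, (i ∈ S ↔ i ∈ T)) (g : Config N → ℂ) :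
    l.foldr (fun i h => if i ∈ S then cellAvg N L i h else h - cellAvg N L i h) g =
      l.foldr (fun i h => if i ∈ T then cellAvg N L i h else h - cellAvg N L i h) g := by
  induction l with
  | nil => rfl
  | cons a l ih =>
    have ha := hST a List.mem_cons_self
    rw [List.foldr_cons, List.foldr_cons, ih fun i hi => hST i (List.mem_cons_of_mem a hi)]
    by_cases haS : a ∈ S
    · rw [if_pos haS, if_pos (ha.1 haS)]
    · rw [if_neg haS, if_neg fun h => haS (ha.2 h)]

/-- `Σ_{U ⊆ l} (foldr over l for U) g = g`: each factor splits as `P_a + (1 - P_a) = 1`. -/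
private theorem sum_powerset_foldr (l : List (Fin N)) (hl : l.Nodup) (g : Config N → ℂ) :
    ∑ U ∈ l.toFinset.powerset,
      l.foldr (fun i h => if i ∈ U then cellAvg N L i h else h - cellAvg N L i h) g = g := by
  induction l with
  | nil => simp
  | cons a l ih =>
    rw [List.nodup_cons] at hl
    have hal : a ∉ l.toFinset := fun h => hl.1 (List.mem_toFinset.1 h)
    rw [List.toFinset_cons, Finset.sum_powerset_insert hal, ← Finset.sum_add_distrib]
    refine Eq.trans (Finset.sum_congr rfl fun U hU => ?_) (ih hl.2)
    have haU : a ∉ U := fun h => hal (Finset.mem_powerset.1 hU h)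
    have h3 :
        l.foldr (fun i h => if i ∈ insert a U then cellAvg N L i h else h - cellAvg N L i h) g =
          l.foldr (fun i h => if i ∈ U then cellAvg N L i h else h - cellAvg N L i h) g :=
      foldr_congr_set l (fun i hi => by
        have hia : i ≠ a := fun e => hl.1 (e ▸ hi)
        simp only [Finset.mem_insert, hia, false_or]) g
    rw [List.foldr_cons, List.foldr_cons, if_neg haU, if_pos (Finset.mem_insert_self a U), h3]
    exact sub_add_cancel _ _

/-- **Resolution of the identity**: `Σ_S Q_S g = g`. [folklore] -/
private theorem sum_modeProj (g : Config N → ℂ) : ∑ S : Finset (Fin N), modeProj N L S g = g := by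
  unfold modeProj
  have h := sum_powerset_foldr (L := L) (List.finRange N) (List.nodup_finRange N) g
  rwa [List.toFinset_finRange, Finset.powerset_univ] at h

/-- Two consecutive steps of the `foldr` commute on continuous functions. [folklore] -/
private theorem step_comm (S : Finset (Fin N)) (a b : Fin N) {h : Config N → ℂ}
    (hc : Continuous h) :
    (if a ∈ S then cellAvg N L a (if b ∈ S then cellAvg N L b h else h - cellAvg N L b h)
      else (if b ∈ S then cellAvg N L b h else h - cellAvg N L b h) -
        cellAvg N L a (if b ∈ S then cellAvg N L b h else h - cellAvg N L b h)) =
    (if b ∈ S then cellAvg N L b (if a ∈ S then cellAvg N L a h else h - cellAvg N L a h)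
      else (if a ∈ S then cellAvg N L a h else h - cellAvg N L a h) -
        cellAvg N L b (if a ∈ S then cellAvg N L a h else h - cellAvg N L a h)) := by
  have hca := continuous_cellAvg (L := L) a hc
  have hcb := continuous_cellAvg (L := L) b hc
  have hcomm := cellAvg_comm (L := L) a b hc
  by_cases haS : a ∈ S <;> by_cases hbS : b ∈ S
  · simp only [if_pos haS, if_pos hbS]
    exact hcomm
  · simp only [if_pos haS, if_neg hbS]
    rw [cellAvg_sub a hc hcb, hcomm]
  · simp only [if_neg haS, if_pos hbS]
    rw [cellAvg_sub b hc hca, hcomm]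
  · simp only [if_neg haS, if_neg hbS]
    rw [cellAvg_sub a hc hcb, cellAvg_sub b hc hca, hcomm]
    abel

/-- The `foldr` does not depend on the order of its (commuting) factors. [folklore] -/
private theorem foldr_perm (S : Finset (Fin N)) {l₁ l₂ : List (Fin N)} (p : l₁.Perm l₂)
    {g : Config N → ℂ} (hg : Continuous g) :
    l₁.foldr (fun i h => if i ∈ S then cellAvg N L i h else h - cellAvg N L i h) g =
      l₂.foldr (fun i h => if i ∈ S then cellAvg N L i h else h - cellAvg N L i h) g := by
  induction p with
  | nil => rfl
  | cons a _ ih => rw [List.foldr_cons, List.foldr_cons, ih]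
  | swap a b l =>
    simp only [List.foldr_cons]
    exact step_comm S b a (continuous_foldr S l hg)
  | trans _ _ ih₁ ih₂ => exact ih₁.trans ih₂

/-- Relabelling intertwines the cell averages: `(P_j h)(X ∘ τ) = (P_{τ j} (h ∘ (· ∘ τ)))(X)`.
[folklore] -/
private theorem cellAvg_comp_perm (τ : Equiv.Perm (Fin N)) (j : Fin N) (h : Config N → ℂ)
    (X : Config N) :
    cellAvg N L j h (X ∘ τ) = cellAvg N L (τ j) (fun Y => h (Y ∘ τ)) X := by
  unfold cellAvg
  simp only [Function.update_comp_equiv, Equiv.symm_apply_apply]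

/-- Relabelling carries the `foldr` to the `foldr` with relabelled cell averages. [folklore] -/
private theorem foldr_comp_perm (τ : Equiv.Perm (Fin N)) (S : Finset (Fin N)) (l : List (Fin N))
    (g : Config N → ℂ) :
    (fun X => l.foldr (fun i h => if i ∈ S then cellAvg N L i h else h - cellAvg N L i h) g
        (X ∘ τ)) =
      l.foldr (fun i h => if i ∈ S then cellAvg N L (τ i) h else h - cellAvg N L (τ i) h)
        (fun X => g (X ∘ τ)) := by
  induction l with
  | nil => rfl
  | cons a l ih =>
    simp only [List.foldr_cons]
    rw [← ih]
    funext X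
    by_cases haS : a ∈ S
    · simp only [if_pos haS]
      exact cellAvg_comp_perm τ a _ X
    · simp only [if_neg haS, Pi.sub_apply]
      rw [cellAvg_comp_perm τ a _ X]

/-- **`Q_S` is relabelling-covariant**, `(Q_S g)(X ∘ τ) = (Q_{τS} (g ∘ (· ∘ τ)))(X)` (re-index the
relabelled `foldr` along `τ` and reorder its commuting factors). [folklore] -/
private theorem modeProj_comp_perm (τ : Equiv.Perm (Fin N)) (S : Finset (Fin N)) {g : Config N → ℂ}
    (hg : Continuous g) :
    (fun X => modeProj N L S g (X ∘ τ)) =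
      modeProj N L (S.map τ.toEmbedding) (fun X => g (X ∘ τ)) := by
  have hgc : Continuous fun X : Config N => g (X ∘ τ) :=
    hg.comp (continuous_pi fun j => continuous_apply (τ j))
  have hmap : ((List.finRange N).map τ).foldr (fun i h => if i ∈ S.map τ.toEmbedding
        then cellAvg N L i h else h - cellAvg N L i h) (fun X => g (X ∘ τ)) =
      (List.finRange N).foldr (fun i h => if i ∈ S then cellAvg N L (τ i) h
        else h - cellAvg N L (τ i) h) (fun X => g (X ∘ τ)) := by
    rw [List.foldr_map]
    simp only [Finset.mem_map_equiv, Equiv.symm_apply_apply]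
  unfold modeProj
  rw [foldr_comp_perm τ S (List.finRange N) g, ← hmap]
  exact foldr_perm (S.map τ.toEmbedding) (Equiv.Perm.map_finRange_perm τ) hgc

/-- **Orthogonality** of `Q_S g`, `Q_T g` for `S ≠ T` in `L²(cell^N)` (insert `P_i`, `i ∈ S △ T`, on
the side containing `i` and move it across by self-adjointness, where it annihilates). [folklore] -/
private theorem integral_conj_modeProj_mul_modeProj {n : ℕ} (hL : 0 < L)
    {S T : Finset (Fin (n + 1))} (hST : S ≠ T) {g : Config (n + 1) → ℂ} (hg : Continuous g) :
    ∫ X in cellN (n + 1) L, conj (modeProj (n + 1) L S g X) * modeProj (n + 1) L T g X = 0 := by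
  obtain ⟨i, hi⟩ : ∃ i, ¬(i ∈ S ↔ i ∈ T) := not_forall.1 fun h => hST (Finset.ext h)
  have hS := continuous_modeProj (L := L) S hg
  have hT := continuous_modeProj (L := L) T hg
  have h1 := cellAvg_modeProj hL S i hg
  have h2 := cellAvg_modeProj hL T i hg
  by_cases hiS : i ∈ S
  · have hiT : i ∉ T := fun h => hi (iff_of_true hiS h)
    rw [if_pos hiS] at h1; rw [if_neg hiT] at h2
    calc ∫ X in cellN (n + 1) L, conj (modeProj (n + 1) L S g X) * modeProj (n + 1) L T g X
        = ∫ X in cellN (n + 1) L, conj (cellAvg (n + 1) L i (modeProj (n + 1) L S g) X) *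
            modeProj (n + 1) L T g X := by rw [h1]
      _ = ∫ X in cellN (n + 1) L, conj (modeProj (n + 1) L S g X) *
            cellAvg (n + 1) L i (modeProj (n + 1) L T g) X :=
          (integral_conj_mul_cellAvg i hS hT).symm
      _ = 0 := by simp [h2]
  · have hiT : i ∈ T := of_not_not fun h => hi (iff_of_false hiS h)
    rw [if_neg hiS] at h1; rw [if_pos hiT] at h2
    calc ∫ X in cellN (n + 1) L, conj (modeProj (n + 1) L S g X) * modeProj (n + 1) L T g X
        = ∫ X in cellN (n + 1) L, conj (modeProj (n + 1) L S g X) *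
            cellAvg (n + 1) L i (modeProj (n + 1) L T g) X := by rw [h2]
      _ = ∫ X in cellN (n + 1) L, conj (cellAvg (n + 1) L i (modeProj (n + 1) L S g) X) *
            modeProj (n + 1) L T g X := integral_conj_mul_cellAvg i hS hT
      _ = 0 := by simp [h1]

/-- `∫ conj(φ) φ = ∫ |φ|²` as a complex number. [folklore] -/
private theorem integral_conj_mul_self (φ : Config N → ℂ) :
    ∫ X in cellN N L, conj (φ X) * φ X = ((∫ X in cellN N L, ‖φ X‖ ^ 2 : ℝ) : ℂ) := by
  simp_rw [Complex.conj_mul', ← Complex.ofReal_pow]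
  exact integral_ofReal

/-- **Pythagoras** for the orthogonal family `Q_S g`:
`∫ |Σ_{S∈𝒯} c_S Q_S g|² = Σ_{S∈𝒯} |c_S|² ∫ |Q_S g|²`. [folklore] -/
private theorem integral_norm_sq_sum_modeProj {n : ℕ} (hL : 0 < L)
    (𝒯 : Finset (Finset (Fin (n + 1)))) (c : Finset (Fin (n + 1)) → ℂ) {g : Config (n + 1) → ℂ}
    (hg : Continuous g) :
    ∫ X in cellN (n + 1) L, ‖∑ S ∈ 𝒯, c S * modeProj (n + 1) L S g X‖ ^ 2 =
      ∑ S ∈ 𝒯, ‖c S‖ ^ 2 * ∫ X in cellN (n + 1) L, ‖modeProj (n + 1) L S g X‖ ^ 2 := by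
  have hQ : ∀ S, Continuous (modeProj (n + 1) L S g) := fun S => continuous_modeProj S hg
  have hint : ∀ S T, Integrable (fun X => conj (c S) * c T *
      (conj (modeProj (n + 1) L S g X) * modeProj (n + 1) L T g X))
      ((volume : Measure (Config (n + 1))).restrict (cellN (n + 1) L)) := fun S T =>
    integrableOn_cellN (continuous_const.mul
      ((Complex.continuous_conj.comp (hQ S)).mul (hQ T))) L
  apply Complex.ofReal_injective
  calc ((∫ X in cellN (n + 1) L, ‖∑ S ∈ 𝒯, c S * modeProj (n + 1) L S g X‖ ^ 2 : ℝ) : ℂ)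
      = ∫ X in cellN (n + 1) L, conj (∑ S ∈ 𝒯, c S * modeProj (n + 1) L S g X) *
          ∑ S ∈ 𝒯, c S * modeProj (n + 1) L S g X := (integral_conj_mul_self _).symm
    _ = ∫ X in cellN (n + 1) L, ∑ S ∈ 𝒯, ∑ T ∈ 𝒯, conj (c S) * c T *
          (conj (modeProj (n + 1) L S g X) * modeProj (n + 1) L T g X) := by
        refine integral_congr_ae (Filter.Eventually.of_forall fun X => ?_)
        dsimp only
        rw [map_sum, Finset.sum_mul_sum]
        refine Finset.sum_congr rfl fun S _ => Finset.sum_congr rfl fun T _ => ?_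
        rw [map_mul]
        ring
    _ = ∑ S ∈ 𝒯, ∑ T ∈ 𝒯, ∫ X in cellN (n + 1) L, conj (c S) * c T *
          (conj (modeProj (n + 1) L S g X) * modeProj (n + 1) L T g X) := by
        rw [integral_finsetSum _ fun S _ => integrable_finsetSum _ fun T _ => hint S T]
        exact Finset.sum_congr rfl fun S _ => integral_finsetSum _ fun T _ => hint S T
    _ = ∑ S ∈ 𝒯,
          ((‖c S‖ ^ 2 * ∫ X in cellN (n + 1) L, ‖modeProj (n + 1) L S g X‖ ^ 2 : ℝ) : ℂ) := by
        refine Finset.sum_congr rfl fun S hS => ?_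
        rw [Finset.sum_eq_single_of_mem S hS fun T _ hTS => ?_]
        · rw [integral_const_mul, integral_conj_mul_self, Complex.conj_mul']
          push_cast
          ring
        · rw [integral_const_mul, integral_conj_modeProj_mul_modeProj hL (Ne.symm hTS) hg,
            mul_zero]
    _ = ((∑ S ∈ 𝒯, ‖c S‖ ^ 2 *
          ∫ X in cellN (n + 1) L, ‖modeProj (n + 1) L S g X‖ ^ 2 : ℝ) : ℂ) := by norm_cast

/-- `∫⁻ ‖φ‖₊² = ofReal (∫ |φ|²)` on `cell^N` for continuous `φ`. [folklore] -/
private theorem lintegral_nnnorm_sq_eq (φ : Config N → ℂ) (hφ : Continuous φ) :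
    ∫⁻ X in cellN N L, (‖φ X‖₊ : ℝ≥0∞) ^ 2 = ENNReal.ofReal (∫ X in cellN N L, ‖φ X‖ ^ 2) := by
  simp_rw [coe_nnnorm_sq_eq_ofReal]
  exact (ofReal_integral_eq_lintegral_ofReal (integrableOn_cellN (hφ.norm.pow 2) L)
    (Filter.Eventually.of_forall fun X => sq_nonneg ‖φ X‖)).symm

/-- `Σ_S ∫|Q_S ψ|² = ∫|ψ|² = 1` for a trial state. [folklore] -/
private theorem sum_integral_norm_sq_modeProj {m : ℕ} (hL : 0 < L)
    (Φ : PeriodicTrialState (m + 1) L) :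
    ∑ S : Finset (Fin (m + 1)), ∫ X in cellN (m + 1) L, ‖modeProj (m + 1) L S Φ.ψ X‖ ^ 2 = 1 := by
  have hψ : Continuous Φ.ψ := Φ.contDiff.continuous
  have h := integral_norm_sq_sum_modeProj hL Finset.univ (fun _ => (1 : ℂ)) hψ
  simp only [one_mul, norm_one, one_pow] at h
  have hid : ∀ X, ∑ S : Finset (Fin (m + 1)), modeProj (m + 1) L S Φ.ψ X = Φ.ψ X := fun X => by
    have h' := congrFun (sum_modeProj (L := L) Φ.ψ) X
    rwa [Finset.sum_apply] at h'
  simp only [hid] at h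
  rw [← h]
  have hn := Φ.norm_eq
  rwa [lintegral_nnnorm_sq_eq _ hψ, ENNReal.ofReal_eq_one] at hn

/-- `∫ |Θ|² = Σ_{S∋0} |S|⁻¹ ∫ |Q_S ψ|²`. [folklore] -/
private theorem integral_norm_sq_theta {m : ℕ} (hL : 0 < L) {ψ : Config (m + 1) → ℂ}
    (hψ : Continuous ψ) :
    ∫ X in cellN (m + 1) L, ‖theta m L ψ X‖ ^ 2 =
      ∑ S ∈ (Finset.univ : Finset (Finset (Fin (m + 1)))).filter (fun S => (0 : Fin (m + 1)) ∈ S),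
        (S.card : ℝ)⁻¹ * ∫ X in cellN (m + 1) L, ‖modeProj (m + 1) L S ψ X‖ ^ 2 := by
  unfold theta
  rw [integral_norm_sq_sum_modeProj hL _ (fun S => ((Real.sqrt (S.card : ℝ) : ℂ))⁻¹) hψ]
  refine Finset.sum_congr rfl fun S _ => ?_
  rw [norm_inv, Complex.norm_real, Real.norm_eq_abs, inv_pow, sq_abs,
    Real.sq_sqrt (Nat.cast_nonneg _)]

/-- **Bose symmetry**: `∫ |Q_{τS} ψ|² = ∫ |Q_S ψ|²` (relabelling covariance of `Q_S`,
`ψ ∘ (· ∘ τ) = ψ`, and relabelling invariance of Lebesgue measure on the cell). [folklore] -/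
private theorem integral_norm_sq_modeProj_map {m : ℕ} (Φ : PeriodicTrialState (m + 1) L)
    (τ : Equiv.Perm (Fin (m + 1))) (S : Finset (Fin (m + 1))) :
    ∫ X in cellN (m + 1) L, ‖modeProj (m + 1) L (S.map τ.toEmbedding) Φ.ψ X‖ ^ 2 =
      ∫ X in cellN (m + 1) L, ‖modeProj (m + 1) L S Φ.ψ X‖ ^ 2 := by
  have hψ : Continuous Φ.ψ := Φ.contDiff.continuous
  have hsymm : (fun X => Φ.ψ (X ∘ τ)) = Φ.ψ := funext fun X => Φ.symm τ X
  have hQ := continuous_modeProj (L := L) S hψ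
  have hQτ : Continuous fun X : Config (m + 1) => modeProj (m + 1) L S Φ.ψ (X ∘ τ) :=
    hQ.comp (continuous_pi fun j => continuous_apply (τ j))
  have h1 : modeProj (m + 1) L (S.map τ.toEmbedding) Φ.ψ =
      fun X => modeProj (m + 1) L S Φ.ψ (X ∘ τ) := by
    rw [modeProj_comp_perm τ S hψ, hsymm]
  rw [h1]
  have h2 := setLIntegral_cellN_comp_perm (L := L) τ
    (fun X => (‖modeProj (m + 1) L S Φ.ψ X‖₊ : ℝ≥0∞) ^ 2)
  rw [lintegral_nnnorm_sq_eq _ hQτ, lintegral_nnnorm_sq_eq _ hQ] at h2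
  exact (ENNReal.ofReal_eq_ofReal_iff (integral_nonneg fun X => sq_nonneg _)
    (integral_nonneg fun X => sq_nonneg _)).1 h2

/-- By Bose symmetry the weighted mass seen from particle `i` equals that seen from particle `0`
(re-index `S ↦ τS`, `τ = swap 0 i`). [folklore] -/
private theorem sum_filter_mem_eq {m : ℕ} (Φ : PeriodicTrialState (m + 1) L) (i : Fin (m + 1)) :
    ∑ S ∈ (Finset.univ : Finset (Finset (Fin (m + 1)))).filter (fun S => i ∈ S),
        (S.card : ℝ)⁻¹ * ∫ X in cellN (m + 1) L, ‖modeProj (m + 1) L S Φ.ψ X‖ ^ 2 =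
      ∑ S ∈ (Finset.univ : Finset (Finset (Fin (m + 1)))).filter (fun S => (0 : Fin (m + 1)) ∈ S),
        (S.card : ℝ)⁻¹ * ∫ X in cellN (m + 1) L, ‖modeProj (m + 1) L S Φ.ψ X‖ ^ 2 := by
  rw [Finset.sum_filter, Finset.sum_filter,
    ← Equiv.sum_comp (Equiv.finsetCongr (Equiv.swap (0 : Fin (m + 1)) i))]
  refine Finset.sum_congr rfl fun S _ => ?_
  simp only [Equiv.finsetCongr_apply, Finset.mem_map_equiv, Equiv.symm_swap,
    Equiv.swap_apply_right, Finset.card_map, integral_norm_sq_modeProj_map]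

/-- Counting: `Σ_i Σ_{S∋i} |S|⁻¹ w_S = Σ_{S≠∅} w_S ≤ Σ_S w_S` for `w ≥ 0`. [folklore] -/
private theorem sum_sum_filter_le (w : Finset (Fin N) → ℝ) (hw : ∀ S, 0 ≤ w S) :
    ∑ i : Fin N, ∑ S ∈ (Finset.univ : Finset (Finset (Fin N))).filter (fun S => i ∈ S),
        (S.card : ℝ)⁻¹ * w S ≤ ∑ S : Finset (Fin N), w S := by
  calc ∑ i : Fin N, ∑ S ∈ (Finset.univ : Finset (Finset (Fin N))).filter (fun S => i ∈ S),
        (S.card : ℝ)⁻¹ * w S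
      = ∑ S : Finset (Fin N), ∑ i : Fin N, if i ∈ S then (S.card : ℝ)⁻¹ * w S else 0 := by
        simp only [Finset.sum_filter]
        exact Finset.sum_comm
    _ = ∑ S : Finset (Fin N), (S.card : ℝ) * ((S.card : ℝ)⁻¹ * w S) := by
        refine Finset.sum_congr rfl fun S _ => ?_
        rw [Finset.sum_ite_mem, Finset.univ_inter, Finset.sum_const, nsmul_eq_mul]
    _ ≤ ∑ S : Finset (Fin N), w S := by
        refine Finset.sum_le_sum fun S _ => ?_
        by_cases h : (S.card : ℝ) = 0
        · rw [h, zero_mul]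
          exact hw S
        · rw [mul_inv_cancel_left₀ h]

/-- **Stub A2 `stub_thetaNorm` (Bose counting)**: `N ∫_{cell^N} |Θ|² ≤ 1` for the
`Θ = Σ_{S∋0} |S|^{-1/2} Q_S ψ` of a periodic Bose trial state with `N = m + 1` particles:
`N Σ_{S∋0}|S|⁻¹‖Q_Sψ‖² = Σ_i Σ_{S∋i}|S|⁻¹‖Q_Sψ‖² = Σ_{S≠∅}‖Q_Sψ‖² ≤ ‖ψ‖² = 1`. [folklore] -/
theorem stub_thetaNorm :
    ∀ m : ℕ, ∀ L : ℝ, 0 < L → ∀ Φ : PeriodicTrialState (m + 1) L,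
      ((m + 1 : ℕ) : ℝ≥0∞) * ∫⁻ X in cellN (m + 1) L, (‖theta m L Φ.ψ X‖₊ : ℝ≥0∞) ^ 2 ≤ 1 := by
  intro m L hL Φ
  have hψ : Continuous Φ.ψ := Φ.contDiff.continuous
  have hθ : Continuous (theta m L Φ.ψ) := by
    unfold theta
    exact continuous_finsetSum _ fun S _ => continuous_const.mul (continuous_modeProj S hψ)
  rw [lintegral_nnnorm_sq_eq _ hθ, ← ENNReal.ofReal_natCast,
    ← ENNReal.ofReal_mul (Nat.cast_nonneg (m + 1)), ENNReal.ofReal_le_one,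
    integral_norm_sq_theta hL hψ]
  have hle := sum_sum_filter_le (N := m + 1) (fun S => ∫ X in cellN (m + 1) L,
    ‖modeProj (m + 1) L S Φ.ψ X‖ ^ 2) fun S => integral_nonneg fun X => sq_nonneg _
  simp only [sum_filter_mem_eq Φ, Finset.sum_const, Finset.card_univ, Fintype.card_fin,
    nsmul_eq_mul] at hle
  rwa [sum_integral_norm_sq_modeProj hL Φ] at hle

end Summit.AtomisticToContinuum.BoseEinsteinCondensation.Cruxes.GaussianDominationCan.CouplingMonotoneChord

end
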